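import Mathlib.RingTheory.Perfection
import Mathlib.Algebra.CharP.Algebra
import Mathlib.Topology.Algebra.Valued.NormedValued
import Mathlib.SetTheory.Cardinal.Basic
import Summits.ABC.IUTFork.Joshi.ArithTeichmullerSpace
import HarnessLib

/-!
# K. Joshi, *Arithmetic Teichmüller spaces I* (arXiv:2106.11452v4) §4 «Arithmetic holomorphic structures» — the OBJECT
# `(X/E, (K ⊃ E, K♭ ≃ F), ∗_K : M(K) → X^an_E)` of Def. 4.1.1, with the TILT typed CONCRETELY, and §4's items 4.1.2–4.3.1

Record file of the abc-iut cell, block E «type Joshi's construction, test vs S» (rung LADDER-ABC:A2.E; human ruling D-0078; seat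
abc-iut-E-t10, slot T-46 of the [J-I] fan-out, E-plan-2 2026-08-26T07:04:11Z; inventory `plan/E/t10/INVENTORY-J1s4.tsv`). Source of record:
the cell's PDF-paged render `HOME/plan/repair/lit/renders/Joshi-ATS1-2106.11452v4-PDFpaged-book-anonnd/pNNNN.txt` («p.N l.M» = line M
of page file N) of [J-I] = K. Joshi, *Construction of Arithmetic Teichmüller Spaces and some applications*, arXiv:2106.11452 **v4**
(unrefereed; bib `Joshi2021ATS1`; registry ids `J1:…` in v4 numbering, JOSHI-DAG.md §7). TAKES NO SIDE on [IUTchIII] Cor. 3.12, on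
Joshi's claims or on Mochizuki's reports (Mochizuki2024JoshiReport (ShtAns) attaches to Def. 4.1.1 / Rmk. 4.2.1 — located, not
adjudicated). TYPED ≠ PROVED ≠ ENDORSED: Joshi's DATA are structures/defs with the printed locator; every statement he ASSERTS is a
`Prop`-valued `def` tagged `@[claim "Joshi2021ATS1" "disputed"]` (the status word of E-t1's landed [J-I] file), never an axiom /
instance / `sorry` / Literature fact; what FOLLOWS from the typed signature is a proved `theorem`. RULES of the fan-out respected:
E-t1's carriers (`Joshi.Untilt`, `Untilt.TopEquiv/TopIso`, `Joshi.ATSObj`, `ATSObj.self`) are IMPORTED BY NAME and never re-typed; this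
file supplies exactly the two data E-t1's `ArithTeichmullerSpace.lean` leaves outside its interface boundary (l.57–60): the tilt datum
`K♭ ≃ F` and the geometric base point `∗_K`. No FACT-LIST row is consumed; no `Cor312*`/`Thm311*` file is imported (E-PLAN R14).

## What is typed (PDF pp.18–22)
* §4.1 set-up (p.18 l.4–10): Berkovich spectra `M(A)`, analytic spaces `X^an_E`, `X^an_K` — NO carrier in Mathlib or the tree, so the
  morphisms `M(K) → X^an_E` (and Rmk. 4.1.11's `M(K) → X^an_K` with its composite) are an ABSTRACT datum `BerkovichDatum X`.
* **Def. 4.1.1** (p.18 l.11–22): `ArithHolStructure X A F` = (1) an untilt `(K ⊃ E, K♭ ≃ F)` of an algebraically closed perfectoid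
  field `F` of characteristic `p` — `U : Joshi.Untilt p` (E-t1), `emb : E →+* K` continuous on `ℚ_p` (E-t1's convention), and the
  TILT ISO `tiltIso : K♭ ≃+* F` where **`K♭ := ATS1.tilt U` is Mathlib's `Tilt K ‖·‖ 𝒪_K p`** (the fraction field of the perfection of
  `𝒪_K/p`; `charP_tilt` PROVED; the tilt is [J-I] §3.3 p.9 l.31–33), with the isometry of [J-I] §3.5 p.9 l.38–40 («with an isometry
  K♭ ≃ F») carried by the multiplicative isometric untilting map `sharp = ♯ ∘ ι⁻¹ : F →*₀ K` (reading note (e)); (2) the base point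
  `basePt : A.BasePt U emb`. Morphisms «of the data»: `ArithHolStructure.Iso` (READING, flagged below).
* **Def. 4.1.2** (p.18 l.23–30) `GeomBasePoint`; **Rmk. 4.1.3** (p.18 l.31–43) reading (+ (1) holds BY TYPING: the field of a base point is
  an `Untilt`); **Lem. 4.1.4** (p.18 l.44–p.19 l.3) `geomBasePoint`, DISCHARGED (`rfl`); **Prop. 4.1.5** (p.19 l.5–19) the sequence
  `1 → Π^temp_{X/K} → Π^temp_{X/E} → G_{E;K} → 1` read off the base-point-free [SemiAnbd] §6 carrier `TemperedCurve` — its independence of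
  the arithmetic holomorphic structure is then LITERAL (`piData_indep`, `rfl`): a feature of the carrier (Thm. 3.10.1 (1)(2) built in, as
  E-t1's `geomSubgroup` docstring records), not a proof of Thm. 3.10.1.
* **Prop. 4.1.7** (p.19 l.22–51): (1) `charZero` PROVED; «same cardinality» `SameCardinality`, «same residue fields» `SameResidueField`,
  «same value groups as that of F» `SameValueGroup` (typed CONCRETELY: `range ‖·‖_K = range ‖·‖_F`) — claim-defs; (2) `ExistsNonIso`,
  `NeedNotBeTopIso` — claim-defs ([FF18 Cor. 2.2.22], [KedlayaTemkin2018], Thm. 3.16.1 = slot T-45).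
* **Rmk. 4.1.8** reading; **Rmk. 4.1.9** (p.20 l.1–7) [Kedlaya–Temkin]: `QbarNotDense` statement shell (cited, never consumed).
* **Prop. 4.1.10** (p.20 l.8–65) the forgetful functors = projections `toGeomBasePoint`, `toField`, `toTilt`, `piTemp`, and
  `toATSObj := ATSObj.self` (E-t1) into `𝔍(X,E)` (Def. 5.1.1 allows `Y = X`), functorial on isomorphisms (`toATSObj_iso`, PROVED).
* **Rmk. 4.1.11** (p.20 l.66–p.21 l.8) `ofOverK`; **§4.2** notation (p.21 l.9–21: the contractions drop NO data — «let me caution the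
  reader»); **Rmk. 4.2.1** (p.21 l.22–37): (1) «the tilting datum K♭ ≃ F allows us to compute arithmetic degrees in one fixed location
  namely the value group of F even as the untilt moves» = `degK` with `degK_eq` PROVED (the degree of `y ∈ F` realised in any untilt over
  `F` is `‖y‖_F`) and `range_norm_F_subset` (half of Prop. 4.1.7 (1)'s value-group clause, PROVED) — the (ShtAns)-adjacent sentence of §4 as
  kernel objects; (2) étale-picture / Frobenius-picture reading (DICTIONARY).
* **Prop. 4.3.1** (p.21 l.49–p.22 l.14), the functor to the diamond `X^♦_E(F)`: LOCATOR-ONLY — no adic spaces / diamonds in Mathlib or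
  the tree; an abstract shell would carry no content (inventory row, no decl).

## Reading notes for the referee lanes (own render)
(a) `Iso` = «morphisms of the data» (p.18 l.20–22) read as: a topological isomorphism of the untilts (E-t1's `TopEquiv`) compatible with
the embeddings of `E` and carrying base point to base point along the Berkovich datum's transport; compatibility with the tilt isos is
NOT recorded (Mathlib has no functoriality of `Tilt` in field isomorphisms) — WEAKER-THAN-PRINT on that component, flagged. (b) `F` is a
PARAMETER with Mathlib classes (`NormedField`, `CompleteSpace`, `IsUltrametricDist`, `IsAlgClosed`, `CharP F p`): Def. 4.1.1 (1)'s «for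
SOME algebraically closed, perfectoid field F» is the Σ-type over it; `𝔍(X,E)_F` (Def. 5.6.2, slot T-47) fixes `F` anyway. (c) Prop.
4.1.7 (1) «same residue fields»: typed over Mathlib's `IsLocalRing.ResidueField` of the valuation subrings. (d) continuity of `E ↪ K` on
`ℚ_p` only = E-t1's convention (unique extension of the valuation to the finite extension `E`). (e) the isometry «with an isometry
K♭ ≃ F» ([J-I] §3.5 p.9 l.38–40): Mathlib's `Tilt` carries no norm, and the ring structure of `PreTilt 𝒪_K p` (where `PreTilt.val` /
`PreTilt.untilt` live) needs the instance `Fact (¬ IsUnit (p : 𝒪_K))`, which a statement file may not install (no instances; it IS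
available inside proofs: `charP_tilt`); so the isometry is carried by the posited multiplicative isometric map `sharp : F →*₀ K`
(«y ↦ (ι⁻¹ y)^♯», |y|_{K♭} := |y^♯|_K), and its agreement with `PreTilt.untilt ∘ ι⁻¹` on `𝒪_F` is merge-debt M-t10-1 (to be discharged
when that plumbing is available). (f) NON-VACUITY of `ArithHolStructure X A F` is NOT constructible
today: Mathlib puts no norm / completeness / algebraic-closedness structure on `Tilt`, and holds no model of an algebraically closed
perfectoid field of characteristic `p` to serve as `F` with `K♭ ≃+* F` (e.g. `ℂ_p♭`); satisfiability rests on [Scholze 2012, Lem. 3.4]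
(`ℂ_p` is an untilt of `ℂ_p♭`) — recorded, not built. `Untilt p` itself is inhabited (E-t1's `Untilt.padicComplex`).

## DICTIONARY (E3; Joshi's sentences, recorded not endorsed)
D-t10-4 (Rmk. 4.1.3 (2), p.18 l.40–43): «[IUTchI, §I3, p.21] requires arbitrary geometric base-points … This is how algebraically closed
perfectoid fields enter [IUTchI–IV]» ↔ OUR typing is base-point-free (`Thm311.*` profinite/tempered groups as abstract topological groups;
`TemperedCurve.PiTemp`). D-t10-5 (Rmk. 4.2.1 (2), p.21 l.27–37): «K provides "étale-picture" … (Π^temp_{X/E;K}, G_{E;K}) … the tilting data is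
"Frobenius-picture"» ↔ OUR étale-like (coric `Thm311` group data) vs Frobenius-like (monoid / splitting) data of the log-theta-lattice.
Merge-debts: none inward (E-t1's carriers imported); outward: slots T-45 (Thm. 3.10.1 / 3.16.1), T-47/T-48 (J(X,E)_F, Thm. 5.24.1) import
`ArithHolStructure` / `ATS1.tilt`.

REVISION r1 (referee E-ref-3 defect D2, 2026-08-26T09:24:08Z): DOCSTRING-ONLY — every declaration is byte-identical to p431050. The
isometry clause of Def. 4.1.1 (1) was addressed to «[J-I] §3.3 p.9 l.31–33», which is the TILT («one has naturally associated field K♭ …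
called the tilt of K»); the isometry is [J-I] §3.5 p.9 l.38–40, verbatim «with an isometry K♭ ≃ F» (the earlier guillemeted «K♭
isometric with F» was a gloss, not print). Re-addressed in the summary above, in reading note (e), and in the docstrings of
`ArithHolStructure` and its field `sharp`; typed content (`sharp`, `norm_sharp`) unchanged — it was and is exactly §3.5's clause.
-/

noncomputable section

open scoped NNReal

namespace Summit.ABC.IUTFork.Joshi.ATS1

open Summit.ABC.IUTFork.Joshi Literature.AnabelianGeometry.SemiGraphs

variable {p : ℕ} [Fact p.Prime]

/-! ## §0 The tilt `K♭` of an untilt, concretely (for [J-I] §3.3 p.9 l.31–33 and Def. 4.1.1 (1)) -/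

/-- `‖p‖_K ≠ 1` for an untilt (`‖p‖_K < 1`, E-t1's `Untilt.norm_p_lt_one`) — the hypothesis under which Mathlib's `Tilt` is a field.
[folklore] -/
theorem valuation_p_ne_one (U : Untilt p) : (NormedField.valuation : Valuation U.K ℝ≥0) (p : U.K) ≠ 1 := by
  intro h
  have h1 : ‖(p : U.K)‖₊ = 1 := by simpa [NormedField.valuation_apply] using h
  have h2 : ‖(p : U.K)‖ = 1 := by
    have := congrArg ((↑) : ℝ≥0 → ℝ) h1
    simpa using this
  exact absurd U.norm_p_lt_one (by rw [h2]; exact lt_irrefl 1)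

/-- `𝒪_K`, the valuation ring of the untilt `K` (for `‖·‖`). [folklore] -/
abbrev int (U : Untilt p) : Subring U.K := (NormedField.valuation (K := U.K)).integer

/-- `p ∈ 𝒪_K` is not a unit (`‖p‖ < 1`). [folklore] -/
theorem not_isUnit_p (U : Untilt p) : ¬ IsUnit ((p : ℕ) : int U) := fun h =>
  valuation_p_ne_one U (by
    have := (Valuation.integer.integers (NormedField.valuation (K := U.K))).one_of_isUnit h
    simpa using this)

/-- **`K♭`, the TILT of the untilt `K`** ([J-I] §3.3 p.9 l.31–33 «one has naturally associated field K♭, algebraically closed, perfectoid of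
characteristic p > 0, called the tilt of K and K is called an untilt of K♭ (see [Scholze, 2012, Lemma 3.4])»): Mathlib's
`Tilt K ‖·‖ 𝒪_K p` = the fraction field of the perfection `PreTilt 𝒪_K p` of `𝒪_K/p` — a FIELD (Mathlib instance, found through this
`abbrev`; farm-checked) of characteristic `p` (`charP_tilt`). [folklore] -/
abbrev tilt (U : Untilt p) : Type :=
  @Tilt U.K _ NormedField.valuation (int U) _ _ (Valuation.integer.integers _) p _ ⟨valuation_p_ne_one U⟩

/-- `K♭` has characteristic `p`. PROVED (perfection of `𝒪_K/p`, then fraction field). [folklore] -/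
theorem charP_tilt (U : Untilt p) : CharP (tilt U) p := by
  haveI : Fact (¬ IsUnit ((p : ℕ) : int U)) := ⟨not_isUnit_p U⟩
  haveI := PreTilt.isDomain U.K NormedField.valuation (int U) (Valuation.integer.integers _) p
  exact (inferInstance : CharP (FractionRing (PreTilt (int U) p)) p)

/-! ## §4.1 set-up: Berkovich base points, abstractly (p.18 l.4–10; Rmk. 4.1.11) -/

/-- The Berkovich-side datum of the curve `X/E` (`E = X.K`), ABSTRACT ([J-I] §4.1 p.18 l.4–10: «M(A) the Berkovich spectrum … X^an_E,
X^an_K the analytic spaces arising from X/E»; no Berkovich spaces in Mathlib or the tree): for an untilt `K` receiving `E`, the type of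
morphisms of Berkovich spaces `∗_K : M(K) → X^an_E` over the embedding (Def. 4.1.1 (2), Def. 4.1.2), the type of morphisms
`M(K) → X^an_K`, and composition with the base change `X^an_K → X^an_E` (Rmk. 4.1.11, p.20 l.66–p.21 l.3), plus transport of base points
along topological isomorphisms of untilts compatible with the embeddings (what «morphisms of the data» needs). SIGNATURE; nothing
asserted. [claim: Joshi2021ATS1, status: disputed] -/
structure BerkovichDatum (X : TemperedCurve p) : Type 1 where
  /-- morphisms `M(K) → X^an_E` over `E ↪ K` (K-geometric base points of `X^an_E`, Def. 4.1.2) -/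
  BasePt : ∀ U : Untilt p, (X.K →+* U.K) → Type
  /-- morphisms `M(K) → X^an_K` (K-geometric base points of `X^an_K`, Rmk. 4.1.11) -/
  BasePtK : ∀ U : Untilt p, (X.K →+* U.K) → Type
  /-- Rmk. 4.1.11: composing with `X^an_K → X^an_E` -/
  compose : ∀ (U : Untilt p) (e : X.K →+* U.K), BasePtK U e → BasePt U e
  /-- transport of base points along an isomorphism of untilts compatible with the embeddings (`M(K) ≅ M(K′)`) -/
  transport : ∀ (U U' : Untilt p) (e : X.K →+* U.K) (e' : X.K →+* U'.K) (φ : U.TopEquiv U'),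
    (∀ x, φ.toRingEquiv (e x) = e' x) → BasePt U e → BasePt U' e'

/-! ## Def. 4.1.2 geometric base points; Def. 4.1.1 arithmetic holomorphic structures -/

/-- **[J-I] Def. 4.1.2** (p.18 l.23–30): «a K-geometric base-point (or less precisely, a geometric base-point) of the analytic space X^an_E
is an algebraically closed, complete (rank one) valued field K and an isometric extension of valued fields K/E and a morphism of analytic
spaces ∗_K : M(K) → X^an_E». `K` = E-t1's `Untilt p` (Rmk. 4.1.3 (1): such a `K` IS an algebraically closed perfectoid field, by Lem.
3.2.1 — here by typing); `K/E` = `emb` (continuity on `ℚ_p`, E-t1's convention). [claim: Joshi2021ATS1, status: disputed] -/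
structure GeomBasePoint (X : TemperedCurve p) (A : BerkovichDatum X) : Type 1 where
  /-- the field `K` -/
  U : Untilt p
  /-- `E ↪ K` -/
  emb : X.K →+* U.K
  /-- … continuous on `ℚ_p` -/
  continuous_emb : Continuous fun x : ℚ_[p] => emb (algebraMap ℚ_[p] X.K x)
  /-- `∗_K : M(K) → X^an_E` -/
  pt : A.BasePt U emb

/-- **[J-I] Def. 4.1.1** (p.18 l.11–22): «A (pointed) arithmetic holomorphic structure (X/E, (K ⊃ E, K♭ ≃ F), ∗_K : M(K) → X^an_E) on X/E
consists of (1) a choice of an untilt (K ⊃ E, K♭ ≃ F) for some algebraically closed, perfectoid field F of characteristic p > 0, and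
(2) a choice of a morphism of Berkovich analytic spaces ∗_K : M(K) → X^an_E.» Over the tilt base `F` (a PARAMETER carrying Mathlib's
classes of an algebraically closed perfectoid field of characteristic `p`, reading note (b)) and the Berkovich datum `A`: the untilt
`K` (E-t1's `Untilt`), `E ↪ K`, the TILT ISO `ι : K♭ ≃+* F` on the concrete tilt `ATS1.tilt U` ([J-I] §3.3 p.9 l.31–33), its
ISOMETRY on `𝒪_{K♭}` ([J-I] §3.5 p.9 l.38–40 «with an isometry K♭ ≃ F»), and the base point. §4.2 (p.21 l.9–21): the printed
contractions `(X/E; (K ⊃ E, K♭ ≃ F))`, `(X/E; ↪K)` drop none of these data («let me caution the reader that this is certainly not the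
case») — no contracted variant is declared.
[claim: Joshi2021ATS1, status: disputed] -/
structure ArithHolStructure (X : TemperedCurve p) (A : BerkovichDatum X) (F : Type) [NormedField F] [CompleteSpace F]
    [IsUltrametricDist F] [IsAlgClosed F] [CharP F p] : Type 1 where
  /-- (1) the untilt `K` -/
  U : Untilt p
  /-- (1) `K ⊃ E` -/
  emb : X.K →+* U.K
  /-- … continuous on `ℚ_p` -/
  continuous_emb : Continuous fun x : ℚ_[p] => emb (algebraMap ℚ_[p] X.K x)
  /-- (1) the tilting datum `ι : K♭ ≃ F` — a field isomorphism of the CONCRETE tilt `ATS1.tilt U` with `F` -/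
  tiltIso : tilt U ≃+* F
  /-- (1) … «with an isometry K♭ ≃ F» ([J-I] §3.5 p.9 l.38–40): the composite `♯ ∘ ι⁻¹ : F ≅ K♭ → K`, `y ↦ y^♯` (Fontaine's
  multiplicative untilting map, under which `|y|_{K♭} := |y^♯|_K`), as a multiplicative map … -/
  sharp : F →*₀ U.K
  /-- … that is an ISOMETRY `‖y^♯‖_K = ‖y‖_F` (reading note (e): its agreement with Mathlib's `PreTilt.untilt ∘ ι⁻¹` on `𝒪_F` is NOT
  stated — `PreTilt`'s ring structure needs the instance `Fact (¬ IsUnit (p : 𝒪_K))`, which a statement file may not install;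
  merge-debt M-t10-1) -/
  norm_sharp : ∀ y : F, ‖sharp y‖ = ‖y‖
  /-- (2) the geometric base point `∗_K : M(K) → X^an_E` -/
  basePt : A.BasePt U emb

namespace ArithHolStructure

variable {X : TemperedCurve p} {A : BerkovichDatum X} {F : Type} [NormedField F] [CompleteSpace F] [IsUltrametricDist F]
  [IsAlgClosed F] [CharP F p]

/-- **Morphisms «of the data»** (Def. 4.1.1, p.18 l.20–22) — READING (a): a topological isomorphism of untilts `K ≅ K′` (E-t1's
`Untilt.TopEquiv`) compatible with `E ↪ K`, `E ↪ K′`, carrying `∗_K` to `∗_{K′}`; tilt-iso compatibility NOT recorded (flag (a)).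
[claim: Joshi2021ATS1, status: disputed] -/
structure Iso (S S' : ArithHolStructure X A F) : Type where
  /-- `K ≅ K′`, topologically -/
  fieldEquiv : S.U.TopEquiv S'.U
  /-- compatibility with the embeddings of `E` -/
  emb_comm : ∀ x, fieldEquiv.toRingEquiv (S.emb x) = S'.emb x
  /-- `∗_K ↦ ∗_{K′}` -/
  basePt_comm : A.transport S.U S'.U S.emb S'.emb fieldEquiv emb_comm S.basePt = S'.basePt

/-- «isomorphic arithmetic holomorphic structures». [claim: Joshi2021ATS1, status: disputed] -/
@[claim "Joshi2021ATS1" "disputed"]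
def IsIso (S S' : ArithHolStructure X A F) : Prop := Nonempty (Iso S S')

/-! ### Lem. 4.1.4, Prop. 4.1.10, Rmk. 4.1.11: the base point and the forgetful functors -/

/-- **[J-I] Lem. 4.1.4** (p.18 l.44–p.19 l.3): «Each arithmetic holomorphic structure … is equipped with a K-geometric base-point, namely
the morphism ∗_K : M(K) → X^an_E» («clear from the definitions») — the projection; also the forgetful functor to `(X^an_E, ∗_K)` of Prop.
4.1.10. DISCHARGED (a definition). [claim: Joshi2021ATS1, status: disputed] -/
def toGeomBasePoint (S : ArithHolStructure X A F) : GeomBasePoint X A := ⟨S.U, S.emb, S.continuous_emb, S.basePt⟩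

/-- Lem. 4.1.4's base point is literally `∗_K`. [folklore] -/
theorem toGeomBasePoint_pt (S : ArithHolStructure X A F) : S.toGeomBasePoint.pt = S.basePt := rfl

/-- Prop. 4.1.10 (p.20 l.8–24), the forgetful functor `(X/E, (K ⊃ E, K♭ ≃ F), ∗_K) ↦ K`. [claim: Joshi2021ATS1, status: disputed] -/
def toField (S : ArithHolStructure X A F) : Type := S.U.K

/-- Prop. 4.1.10 (p.20 l.19–24), the forgetful functor `… ↦ (K ⊃ E, K♭ ≃ F)` (the untilt WITH its embedding and tilting datum, base point
forgotten): the triple `(K, E ↪ K, ι)`. [claim: Joshi2021ATS1, status: disputed] -/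
def toUntiltDatum (S : ArithHolStructure X A F) : (U : Untilt p) × (X.K →+* U.K) × (tilt U ≃+* F) := ⟨S.U, S.emb, S.tiltIso⟩

/-- Prop. 4.1.10, the forgetful functor `… ↦ K♭` (the concrete tilt). [claim: Joshi2021ATS1, status: disputed] -/
def toTilt (S : ArithHolStructure X A F) : Type := tilt S.U

/-- Prop. 4.1.10 (p.20 l.36–48), the forgetful functor `… ↦ π^temp_1(X^an_E, ∗_K)`, «the tempered fundamental group functor constructed in
[André, 2003b] using this geometric base-point»: over the [SemiAnbd] §6 carrier the group `Π^temp_{X/E}` is part of `X` (base-point-free),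
so the functor is constant on objects — Prop. 4.1.5's independence made literal. [claim: Joshi2021ATS1, status: disputed] -/
def piTemp (_S : ArithHolStructure X A F) : Type := X.PiTemp

/-- Prop. 4.1.10 composed with Def. 5.1.1 (p.22 l.22–p.23 l.10, which allows `Y = X`): an arithmetic holomorphic structure on `X/E` gives
the object `(X/E, E ↪ K, id)` of E-t1's `𝔍(X,E)` (`ATSObj.self`), forgetting tilt datum and base point — the two data E-t1's typing
omits. [claim: Joshi2021ATS1, status: disputed] -/
def toATSObj (S : ArithHolStructure X A F) : ATSObj X := ATSObj.self X S.U S.emb S.continuous_emb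

/-- The forgetful map to `𝔍(X,E)` is functorial on isomorphisms (an `Iso` of the data gives E-t1's `ATSObj.Iso`). PROVED. [folklore] -/
def toATSObj_iso {S S' : ArithHolStructure X A F} (e : Iso S S') : ATSObj.Iso S.toATSObj S'.toATSObj where
  baseEquiv := RingEquiv.refl _
  fieldEquiv := e.fieldEquiv
  emb_comm x := e.emb_comm x
  piEquiv := ContinuousMulEquiv.refl _
  α_comm _ := rfl

/-- Hence isomorphic arithmetic holomorphic structures give isomorphic objects of `𝔍(X,E)`. PROVED. [folklore] -/
theorem isIso_toATSObj {S S' : ArithHolStructure X A F} (h : S.IsIso S') : S.toATSObj.IsIso S'.toATSObj :=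
  ⟨toATSObj_iso h.some⟩

/-- **Rmk. 4.1.11** (p.20 l.66–p.21 l.8): a base point of `X^an_K` gives one of `X^an_E` by composing with `X^an_K → X^an_E`, «so in defining
J(X,E) one can work instead with the datum ((K ⊃ E, K♭ ≃ F), ∗_K : M(K) → X^an_K)». [claim: Joshi2021ATS1, status: disputed] -/
def ofOverK (U : Untilt p) (emb : X.K →+* U.K) (h : Continuous fun x : ℚ_[p] => emb (algebraMap ℚ_[p] X.K x))
    (ι : tilt U ≃+* F) (sh : F →*₀ U.K) (hsh : ∀ y : F, ‖sh y‖ = ‖y‖) (b : A.BasePtK U emb) : ArithHolStructure X A F :=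
  ⟨U, emb, h, ι, sh, hsh, A.compose U emb b⟩

/-! ### Prop. 4.1.5: the exact sequence (4.1.6), read off the base-point-free carrier -/

/-- **[J-I] Prop. 4.1.5** (p.19 l.5–16): «the geometric base-point provided by Lemma 4.1.4 provides the exact sequence of topological groups
(4.1.6) 1 → Π^temp_{X/K} → Π^temp_{X/E} → G_{E;K} → 1. The isomorphism class of each of the groups and … of this exact sequence … is
independent of the choice of the arithmetic holomorphic structure on X/E and also independent of the choice geometric base-point.»
Typed as the CLAIM that the sequence data attached to any two structures agree; over the carrier it is `piData` below.
[claim: Joshi2021ATS1, status: disputed] -/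
@[claim "Joshi2021ATS1" "disputed"]
def Prop415 (X : TemperedCurve p) (A : BerkovichDatum X) (F : Type) [NormedField F] [CompleteSpace F] [IsUltrametricDist F]
    [IsAlgClosed F] [CharP F p] : Prop :=
  ∀ S S' : ArithHolStructure X A F, S.toATSObj.geomSubgroup = S'.toATSObj.geomSubgroup

/-- The sequence data (4.1.6) of a structure: the geometric subgroup `Π^temp_{X/K} ↪ Π^temp_{X/E}` it provides, via E-t1's
`ATSObj.geomSubgroup` (= `Δ^temp` transported by the label, here `id`). [claim: Joshi2021ATS1, status: disputed] -/
def piData (S : ArithHolStructure X A F) : Subgroup X.PiTemp := S.toATSObj.geomSubgroup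

/-- Prop. 4.1.5 HOLDS over the typed carrier — LITERALLY: the [SemiAnbd] §6 interface is base-point-free (Thm. 3.10.1 (1)(2) built in), so
the sequence does not see the arithmetic holomorphic structure. A feature of the carrier, recorded as such; not a proof of Thm. 3.10.1.
[claim: Joshi2021ATS1, status: disputed] -/
theorem prop415_holds (X : TemperedCurve p) (A : BerkovichDatum X) (F : Type) [NormedField F] [CompleteSpace F]
    [IsUltrametricDist F] [IsAlgClosed F] [CharP F p] : Prop415 X A F := fun _ _ => rfl

/-! ### Prop. 4.1.7: invariants of the untilts; existence of non-isomorphic structures -/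

/-- Prop. 4.1.7 (1), first clause (p.19 l.29): «The valued fields K_1, K_2 have characteristic zero» — PROVED (an `Untilt` is `CharZero` by
E-t1's typing of Lem. 3.2.1). [claim: Joshi2021ATS1, status: disputed] -/
theorem charZero (S : ArithHolStructure X A F) : CharZero S.U.K := inferInstance

/-- Prop. 4.1.7 (1) (p.19 l.29–30): «… the same cardinality … as that of F». CLAIM. -/
@[claim "Joshi2021ATS1" "disputed"]
def SameCardinality (S : ArithHolStructure X A F) : Prop := Cardinal.mk S.U.K = Cardinal.mk F

/-- Prop. 4.1.7 (1) (p.19 l.29–30): «… the same value groups as that of F» — typed CONCRETELY: the sets of norm values of `K` and of `F`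
coincide. This is the clause Rmk. 4.2.1 (1) leans on («compute arithmetic degrees in one fixed location namely the value group of F even
as the untilt moves»). CLAIM ([FF18], [Scholze 2012]); never asserted. -/
@[claim "Joshi2021ATS1" "disputed"]
def SameValueGroup (S : ArithHolStructure X A F) : Prop := Set.range (fun x : S.U.K => ‖x‖) = Set.range (fun y : F => ‖y‖)

/-- Prop. 4.1.7 (1) (p.19 l.29–30): «… the same residue fields … as that of F» — the residue fields of the valuation rings `𝒪_K` and `𝒪_F`
are isomorphic (reading note (c)). CLAIM; never asserted. -/
@[claim "Joshi2021ATS1" "disputed"]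
def SameResidueField (S : ArithHolStructure X A F) : Prop :=
  Nonempty (IsLocalRing.ResidueField (NormedField.valuation (K := S.U.K)).valuationSubring ≃+*
    IsLocalRing.ResidueField (NormedField.valuation (K := F)).valuationSubring)

/-- **Prop. 4.1.7 (2)** (p.19 l.31–36): «There exist arithmetic holomorphic structures … which are not isomorphic» (proof: [FF18 Cor.
2.2.22] «there exist many non-isomorphic untilts»). CLAIM; never asserted. -/
@[claim "Joshi2021ATS1" "disputed"]
def ExistsNonIso (X : TemperedCurve p) (A : BerkovichDatum X) (F : Type) [NormedField F] [CompleteSpace F] [IsUltrametricDist F]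
    [IsAlgClosed F] [CharP F p] : Prop :=
  ∃ S S' : ArithHolStructure X A F, ¬ S.IsIso S'

/-- **Prop. 4.1.7 (2), continued** (p.19 l.37–43): «if F = ℂ_p^♭, then K_1, K_2 need not even be topologically isomorphic fields (and hence
need not be isomorphic as valued fields)» — over a tilt base `F` (the `ℂ_p^♭` case being the one asserted): two structures with
non-homeomorphic untilts exist ([KedlayaTemkin2018] + Thm. 3.16.1, slot T-45). CLAIM; never asserted. -/
@[claim "Joshi2021ATS1" "disputed"]
def NeedNotBeTopIso (X : TemperedCurve p) (A : BerkovichDatum X) (F : Type) [NormedField F] [CompleteSpace F]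
    [IsUltrametricDist F] [IsAlgClosed F] [CharP F p] : Prop :=
  ∃ S S' : ArithHolStructure X A F, ¬ S.U.TopIso S'.U

/-- Non-homeomorphic untilts give non-isomorphic structures (the typed `Iso` carries a `TopEquiv`) — so `NeedNotBeTopIso ⟹ ExistsNonIso`,
the direction print uses («and hence need not be isomorphic»). PROVED. [folklore] -/
theorem existsNonIso_of_needNotBeTopIso (h : NeedNotBeTopIso X A F) : ExistsNonIso X A F := by
  obtain ⟨S, S', hS⟩ := h
  exact ⟨S, S', fun ⟨e⟩ => hS ⟨e.fieldEquiv⟩⟩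

/-- **Rmk. 4.1.9** (p.20 l.1–7): «by [Kedlaya and Temkin, 2018] … there exist algebraically closed, perfectoid fields with an isometrically
embedded ℚ_p and with tilts isometric to ℂ_p^♭, but such that Q̄_p is not necessarily dense in these fields» — statement shell over a tilt
base `F` (print: `F = ℂ_p^♭`): some structure's untilt does not have `Q̄_p` (E-t1's `embPadicComplex`-style image of `AlgebraicClosure ℚ_p`
is replaced by: the algebraic closure of `ℚ_p` INSIDE `K`) dense. CITED THEOREM as Joshi uses it; never consumed as a hypothesis here.
[cite: KedlayaTemkin2018, Thm 1.3] -/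
def QbarNotDense (X : TemperedCurve p) (A : BerkovichDatum X) (F : Type) [NormedField F] [CompleteSpace F] [IsUltrametricDist F]
    [IsAlgClosed F] [CharP F p] : Prop :=
  ∃ S : ArithHolStructure X A F, ¬ Dense {a : S.U.K | ∃ q : Polynomial ℚ_[p], q ≠ 0 ∧
    Polynomial.eval₂ (S.emb.comp (algebraMap ℚ_[p] X.K)) a q = 0}

/-! ### Rmk. 4.2.1 (1): arithmetic degrees computed in `F` -/

/-- **Rmk. 4.2.1 (1)** (p.21 l.22–26): «The tilting datum K♭ ≃ F provided by an untilt allows us to compute arithmetic degrees in one fixed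
location namely the value group of F even as the untilt moves (see [Joshi, 2023b] …)»: the DEGREE of `y ∈ F` realised in the untilt `K`
through the tilting datum, `deg_K(y) := ‖y^♯‖_K`. [claim: Joshi2021ATS1, status: disputed] -/
def degK (S : ArithHolStructure X A F) (y : F) : ℝ := ‖S.sharp y‖

/-- The degree realised in ANY untilt equals the degree read in the fixed location `F`: `‖y^♯‖_K = ‖y‖_F`. PROVED from the isometry datum
— so two structures `S`, `S′` over the same `F` assign the SAME degree to `y` «even as the untilt moves». [claim: Joshi2021ATS1, status: disputed] -/
theorem degK_eq (S S' : ArithHolStructure X A F) (y : F) : S.degK y = S'.degK y := by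
  unfold degK; rw [S.norm_sharp, S'.norm_sharp]

/-- Half of Prop. 4.1.7 (1)'s value-group clause is then automatic: every norm value of `F` is a norm value of `K` (via `y ↦ y^♯`).
PROVED; the converse inclusion (every `|a|_K` is some `|y|_F` — [Scholze 2012, Lem. 3.4 (iii)]) is the content of the claim
`SameValueGroup`. [folklore] -/
theorem range_norm_F_subset (S : ArithHolStructure X A F) :
    Set.range (fun y : F => ‖y‖) ⊆ Set.range (fun x : S.U.K => ‖x‖) := by
  rintro _ ⟨y, rfl⟩
  exact ⟨S.sharp y, S.norm_sharp y⟩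

/-- `y^♯ = 0 ↔ y = 0` (isometry). PROVED. [folklore] -/
theorem sharp_eq_zero_iff (S : ArithHolStructure X A F) (y : F) : S.sharp y = 0 ↔ y = 0 := by
  rw [← norm_eq_zero, S.norm_sharp, norm_eq_zero]

end ArithHolStructure

end Summit.ABC.IUTFork.Joshi.ATS1

end
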